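import Literature.NumberTheory.Automorphic.LocalConstantsUniqueness
import Literature.RepresentationTheory.Semisimple.Twist
import Literature.NumberTheory.GaloisRepresentations.AbstractClassFieldTheory
import HarnessLib

/-!
# Local constants of inflated and twisted representations: the bookkeeping objects

Topic `Literature/NumberTheory/Automorphic` (companion of `LocalConstants`,
`LocalConstantsUniqueness`).  In Deligne's proof of the uniqueness of the local constants
(*Les constantes des équations fonctionnelles des fonctions L*, Antwerp II, LNM 349 (1973),
Thm. 4.1; Rohrlich, *Root numbers*, PCMI 18 (2011), Lecture 4, Prop. 4.2 and (4.17)) an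
irreducible representation `ρ` of `W_E` is written `ρ = ρ₀ ⊗ χ` with `χ` unramified and `ρ₀`
factoring through a finite quotient `G = W_E / K` (`K` open of finite index), and the local
constants of the representations `(A ∘ π) ⊗ χ` of `W_E` obtained from representations `A` of `G`
(`π : W_E → G`) are compared for two systems `𝓔`, `𝓔'` (`LocalEpsilonSystem F`).  This file sets
up the two objects of that bookkeeping and their formal properties:

* `WeilDeligneRep.inflTwist K hK χ hχ A` — the Weil–Deligne representation `((A ∘ π) ⊗ χ, 0)` of
  `W_E` (`Representation.twist` of `Literature/RepresentationTheory/Semisimple/Twist`), for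
  `K ≤ W_E` open normal, `χ : W_E →* ℂˣ` trivial on `I_E`; continuity: it is trivial on the open
  subgroup `K ∩ I_E` of `I_E`.  API: `inflTwist_ρ_apply`, `inflTwist_N`,
  `isEquivalent_inflTwist_prod` (`inflTwist (A ⊕ B) ≅ inflTwist A ⊕ inflTwist B`, with
  `WeilDeligneRep.prod` of `LocalConstantsUniqueness`), `isEquivalent_inflTwist_of_equiv`
  (`A ≅ B ⇒ inflTwist A ≅ inflTwist B`).
* `LocalEpsilonSystem.εRatio 𝓔 𝓔' E ψ μ r = ε₀(r) / ε₀'(r)` — the ratio of the constants of two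
  systems, a homomorphism on the Grothendieck group in Deligne's argument: `εRatio_ne_zero`,
  `εRatio_eq_one_iff`, `εRatio_congr` (isomorphism invariance), `εRatio_prod`
  (multiplicativity, from `LocalEpsilonSystem.ε₀_prod`), `εRatio_inflTwist_prod`.
* `WeilDeligneRep.isEquivalent_ofRep` — representations with equivalent `ρ` and `N = 0` are
  equivalent Weil–Deligne representations; `AbstractCFT.conjSub_comap` — `w (π⁻¹ H) w⁻¹ =
  π⁻¹ (π(w) H π(w)⁻¹)` (used to move Brauer data along conjugation).

Definitions with bodies and proved API only; no named facts (D-0026).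

## References

* P. Deligne, *Les constantes des équations fonctionnelles des fonctions L*, LNM 349 (1973),
  Thm. 4.1, §4. [Deligne1973]
* D. Rohrlich, *Root numbers*, IAS/Park City Math. Ser. 18 (2011), Lecture 4, Prop. 4.2.
  [Rohrlich2011]
-/

noncomputable section

open Module MeasureTheory

namespace Literature.NumberTheory.Automorphic

open Literature.NumberTheory.GaloisRepresentations (WeilDeligneRep WeilGroup)
open Literature.NumberTheory.GaloisRepresentations.WeilDeligneRep
open Literature.RepresentationTheory.Semisimple

/-! ### Weil–Deligne representations with `N = 0` -/

section OfRep

variable {E : Type*} [Field E] [ValuativeRel E] [TopologicalSpace E] [IsNonarchimedeanLocalField E]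
  {C : Type*} [Field C] [CharZero C] {V : Type*} [AddCommGroup V] [Module C V]
  {V' : Type*} [AddCommGroup V'] [Module C V']

/-- Two Weil–Deligne representations with `N = 0` whose representations of `W_E` are isomorphic are
isomorphic. Ref: Deligne, Antwerp II (1973), §8.4.1. [folklore] -/
theorem _root_.Literature.NumberTheory.GaloisRepresentations.WeilDeligneRep.isEquivalent_of_repEquiv
    (r : WeilDeligneRep E C V) (r' : WeilDeligneRep E C V') (hr : r.N = 0) (hr' : r'.N = 0)
    (e : r.ρ.Equiv r'.ρ) : r.IsEquivalent r' :=
  ⟨{ toRepEquiv := e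
     comm_N := by rw [hr, hr', LinearMap.comp_zero, LinearMap.zero_comp] }⟩

/-- `ofRep ρ h ≅ ofRep ρ' h'` for isomorphic `ρ ≅ ρ'`. Ref: Deligne, Antwerp II (1973), §8.4.1.
[folklore] -/
theorem _root_.Literature.NumberTheory.GaloisRepresentations.WeilDeligneRep.isEquivalent_ofRep
    {ρ : Representation C (WeilGroup E) V} {ρ' : Representation C (WeilGroup E) V'}
    (h : WeilGroup.IsContinuousRep ρ) (h' : WeilGroup.IsContinuousRep ρ') (e : ρ.Equiv ρ') :
    (ofRep ρ h).IsEquivalent (ofRep ρ' h') :=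
  isEquivalent_of_repEquiv _ _ rfl rfl e

end OfRep

/-! ### Inflation from a finite quotient, twisted by an unramified character -/

section InflTwist

variable {E : Type*} [Field E] [ValuativeRel E] [TopologicalSpace E] [IsNonarchimedeanLocalField E]
  (K : Subgroup (WeilGroup E)) [K.Normal] (hK : IsOpen (K : Set (WeilGroup E)))
  (χ : WeilGroup E →* ℂˣ) (hχ : ∀ u ∈ WeilGroup.inertia E, χ u = 1)
  {V : Type*} [AddCommGroup V] [Module ℂ V] {V' : Type*} [AddCommGroup V'] [Module ℂ V']

/-- **`((A ∘ π) ⊗ χ, 0)`**: the Weil–Deligne representation of `W_E` obtained from a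
representation `A` of the finite quotient `G = W_E / K` (`K` open normal, `π : W_E → G`) by
inflation and twist by the unramified character `χ` (`χ = 1` on `I_E`); it is trivial on the open
subgroup `K ∩ I_E` of `I_E`, hence continuous, and has `N = 0`.  These are the representations
`Ind_H^G ξ ⊗ ω`, `ω ⊗ 1`, … of Rohrlich's Prop. 4.2 / Deligne's proof of Thm. 4.1.
[cite: Rohrlich2011, Lecture 4 Prop. 4.2] -/
def _root_.Literature.NumberTheory.GaloisRepresentations.WeilDeligneRep.inflTwist
    (A : Representation ℂ (WeilGroup E ⧸ K) V) : WeilDeligneRep E ℂ V :=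
  ofRep (Representation.twist (A.comp (QuotientGroup.mk' K)) χ) (by
    refine ⟨K ⊓ WeilGroup.inertia E, inf_le_right, hK.inter (WeilGroup.isOpen_inertia E),
      fun u hu => ?_⟩
    refine LinearMap.ext fun v => ?_
    have h1 : (QuotientGroup.mk' K u : WeilGroup E ⧸ K) = 1 :=
      (QuotientGroup.eq_one_iff u).mpr hu.1
    rw [Representation.twist_apply_apply, MonoidHom.comp_apply, h1, map_one, hχ u hu.2]
    simp)

/-- `(inflTwist A).ρ w = χ(w) • A(π w)`. [folklore] -/
@[simp] theorem _root_.Literature.NumberTheory.GaloisRepresentations.WeilDeligneRep.inflTwist_ρ_apply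
    (A : Representation ℂ (WeilGroup E ⧸ K) V) (w : WeilGroup E) :
    (inflTwist K hK χ hχ A).ρ w = ((χ w : ℂˣ) : ℂ) • A (QuotientGroup.mk' K w) := rfl

/-- `(inflTwist A).ρ = ((A ∘ π) ⊗ χ)`. [folklore] -/
theorem _root_.Literature.NumberTheory.GaloisRepresentations.WeilDeligneRep.inflTwist_ρ
    (A : Representation ℂ (WeilGroup E ⧸ K) V) :
    (inflTwist K hK χ hχ A).ρ = Representation.twist (A.comp (QuotientGroup.mk' K)) χ := rfl

/-- `(inflTwist A).N = 0`. [folklore] -/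
@[simp] theorem _root_.Literature.NumberTheory.GaloisRepresentations.WeilDeligneRep.inflTwist_N
    (A : Representation ℂ (WeilGroup E ⧸ K) V) : (inflTwist K hK χ hχ A).N = 0 := rfl

/-- **Additivity**: `inflTwist (A ⊕ B) ≅ inflTwist A ⊕ inflTwist B` (the identity of `V × V'`).
[folklore] -/
theorem _root_.Literature.NumberTheory.GaloisRepresentations.WeilDeligneRep.isEquivalent_inflTwist_prod
    (A : Representation ℂ (WeilGroup E ⧸ K) V) (B : Representation ℂ (WeilGroup E ⧸ K) V') :
    (inflTwist K hK χ hχ (A.prod B)).IsEquivalent ((inflTwist K hK χ hχ A).prod (inflTwist K hK χ hχ B)) := by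
  refine isEquivalent_of_repEquiv _ _ rfl (by simp) (Representation.Equiv.mk (LinearEquiv.refl ℂ (V × V')) fun w => ?_)
  refine LinearMap.ext fun v => ?_
  simp only [LinearMap.coe_comp, LinearEquiv.coe_coe, Function.comp_apply, LinearEquiv.refl_apply,
    inflTwist_ρ_apply, prod_ρ_apply, Representation.prod_apply_apply, LinearMap.smul_apply,
    LinearMap.prodMap_apply, Prod.smul_mk]

/-- **Isomorphism invariance**: `A ≅ B ⇒ inflTwist A ≅ inflTwist B` (same linear isomorphism).
[folklore] -/
theorem _root_.Literature.NumberTheory.GaloisRepresentations.WeilDeligneRep.isEquivalent_inflTwist_of_equiv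
    {A : Representation ℂ (WeilGroup E ⧸ K) V} {B : Representation ℂ (WeilGroup E ⧸ K) V'}
    (e : A.Equiv B) : (inflTwist K hK χ hχ A).IsEquivalent (inflTwist K hK χ hχ B) := by
  refine isEquivalent_of_repEquiv _ _ rfl rfl (Representation.Equiv.mk e.toLinearEquiv fun w => ?_)
  refine LinearMap.ext fun v => ?_
  have h := congr($(e.isIntertwining' (QuotientGroup.mk' K w)) v)
  simp only [LinearMap.coe_comp, Function.comp_apply] at h
  simp only [LinearMap.coe_comp, Function.comp_apply, inflTwist_ρ_apply,
    LinearMap.smul_apply, map_smul]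
  congr 1

end InflTwist

/-! ### The ratio of the constants of two systems -/

namespace LocalEpsilonSystem

variable {F : Type} [Field F] [ValuativeRel F] [TopologicalSpace F] [IsNonarchimedeanLocalField F]
variable {E : Type} [Field E] [ValuativeRel E] [TopologicalSpace E] [IsNonarchimedeanLocalField E]
  [Algebra F E] [FiniteDimensional F E] [MeasurableSpace E] [BorelSpace E]
variable (𝓔 𝓔' : LocalEpsilonSystem F)

/-- **`ε₀(r) / ε₀'(r)`**, the ratio of the local constants of two systems at `r` (for fixed
`E, ψ, μ`).  Deligne's uniqueness proof shows this ratio is `1` by exploiting that it is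
multiplicative in `r` (`εRatio_prod`), an isomorphism invariant (`εRatio_congr`), and `1` in
dimension one. [cite: Deligne1973, Thm. 4.1] -/
def εRatio (E : Type) [Field E] [ValuativeRel E] [TopologicalSpace E] [IsNonarchimedeanLocalField E]
    [Algebra F E] [FiniteDimensional F E] [MeasurableSpace E] [BorelSpace E]
    {V : Type} [AddCommGroup V] [Module ℂ V] [FiniteDimensional ℂ V]
    (ψ : AddChar E Circle) (μ : Measure E) (r : WeilDeligneRep E ℂ V) : ℂ :=
  𝓔.ε₀ E ψ μ r / 𝓔'.ε₀ E ψ μ r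

variable {ψ : AddChar E Circle} (hψ : ψ.IsContinuousNontrivial) (μ : Measure E) [μ.IsAddHaarMeasure]
  {V : Type} [AddCommGroup V] [Module ℂ V] [FiniteDimensional ℂ V]
  {V' : Type} [AddCommGroup V'] [Module ℂ V'] [FiniteDimensional ℂ V']

omit [μ.IsAddHaarMeasure] in
/-- Unfolding lemma for `εRatio`. [folklore] -/
theorem εRatio_def (r : WeilDeligneRep E ℂ V) :
    𝓔.εRatio 𝓔' E ψ μ r = 𝓔.ε₀ E ψ μ r / 𝓔'.ε₀ E ψ μ r := rfl

include hψ in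
/-- `εRatio ≠ 0` (`ε₀ ≠ 0` for both systems). [cite: Deligne1973, Thm. 4.1] -/
theorem εRatio_ne_zero (r : WeilDeligneRep E ℂ V) : 𝓔.εRatio 𝓔' E ψ μ r ≠ 0 :=
  div_ne_zero (𝓔.ne_zero E ψ μ r hψ) (𝓔'.ne_zero E ψ μ r hψ)

include hψ in
/-- `εRatio r = 1 ↔ ε₀(r) = ε₀'(r)`. [folklore] -/
theorem εRatio_eq_one_iff (r : WeilDeligneRep E ℂ V) :
    𝓔.εRatio 𝓔' E ψ μ r = 1 ↔ 𝓔.ε₀ E ψ μ r = 𝓔'.ε₀ E ψ μ r := by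
  rw [εRatio_def, div_eq_one_iff_eq (𝓔'.ne_zero E ψ μ r hψ)]

include hψ in
/-- **Isomorphism invariance** of `εRatio` (axiom `equiv` of both systems). [cite: Deligne1973, Thm. 4.1] -/
theorem εRatio_congr {r : WeilDeligneRep E ℂ V} {r' : WeilDeligneRep E ℂ V'} (h : r.IsEquivalent r') :
    𝓔.εRatio 𝓔' E ψ μ r = 𝓔.εRatio 𝓔' E ψ μ r' := by
  rw [εRatio_def, εRatio_def, 𝓔.equiv E ψ μ r r' hψ h, 𝓔'.equiv E ψ μ r r' hψ h]

include hψ in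
/-- **Multiplicativity** of `εRatio` on direct sums (`ε₀_prod` for both systems).
[cite: Deligne1973, Thm. 4.1] -/
theorem εRatio_prod (r : WeilDeligneRep E ℂ V) (r' : WeilDeligneRep E ℂ V') :
    𝓔.εRatio 𝓔' E ψ μ (r.prod r') = 𝓔.εRatio 𝓔' E ψ μ r * 𝓔.εRatio 𝓔' E ψ μ r' := by
  rw [εRatio_def, εRatio_def, εRatio_def, 𝓔.ε₀_prod hψ μ r r', 𝓔'.ε₀_prod hψ μ r r',
    mul_div_mul_comm]

include hψ in
/-- `εRatio (inflTwist (A ⊕ B)) = εRatio (inflTwist A) · εRatio (inflTwist B)`. [cite: Deligne1973, Thm. 4.1] -/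
theorem εRatio_inflTwist_prod (K : Subgroup (WeilGroup E)) [K.Normal] (hK : IsOpen (K : Set (WeilGroup E)))
    (χ : WeilGroup E →* ℂˣ) (hχ : ∀ u ∈ WeilGroup.inertia E, χ u = 1)
    (A : Representation ℂ (WeilGroup E ⧸ K) V) (B : Representation ℂ (WeilGroup E ⧸ K) V') :
    𝓔.εRatio 𝓔' E ψ μ (inflTwist K hK χ hχ (A.prod B)) =
      𝓔.εRatio 𝓔' E ψ μ (inflTwist K hK χ hχ A) * 𝓔.εRatio 𝓔' E ψ μ (inflTwist K hK χ hχ B) := by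
  rw [𝓔.εRatio_congr 𝓔' hψ μ (isEquivalent_inflTwist_prod K hK χ hχ A B), εRatio_prod 𝓔 𝓔' hψ μ]

include hψ in
/-- `εRatio (inflTwist A) = εRatio (inflTwist B)` for `A ≅ B`. [cite: Deligne1973, Thm. 4.1] -/
theorem εRatio_inflTwist_congr (K : Subgroup (WeilGroup E)) [K.Normal] (hK : IsOpen (K : Set (WeilGroup E)))
    (χ : WeilGroup E →* ℂˣ) (hχ : ∀ u ∈ WeilGroup.inertia E, χ u = 1)
    {A : Representation ℂ (WeilGroup E ⧸ K) V} {B : Representation ℂ (WeilGroup E ⧸ K) V'} (e : A.Equiv B) :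
    𝓔.εRatio 𝓔' E ψ μ (inflTwist K hK χ hχ A) = 𝓔.εRatio 𝓔' E ψ μ (inflTwist K hK χ hχ B) :=
  𝓔.εRatio_congr 𝓔' hψ μ (isEquivalent_inflTwist_of_equiv K hK χ hχ e)

end LocalEpsilonSystem

end Literature.NumberTheory.Automorphic

/-! ### A lemma on conjugation and pull-back of subgroups -/

namespace Literature.NumberTheory.GaloisRepresentations.AbstractCFT

/-- `w (π⁻¹ H) w⁻¹ = π⁻¹ (π(w) H π(w)⁻¹)` for a homomorphism `π : W → G`. [folklore] -/
theorem conjSub_comap {W G : Type*} [Group W] [Group G] (π : W →* G) (H : Subgroup G) (w : W) :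
    conjSub w (H.comap π) = (H.map (MulAut.conj (π w)).toMonoidHom).comap π := by
  ext x
  rw [mem_conjSub_iff, Subgroup.mem_comap, Subgroup.mem_comap, Subgroup.mem_map_equiv,
    map_mul, map_mul, map_inv, MulAut.conj_symm_apply]

end Literature.NumberTheory.GaloisRepresentations.AbstractCFT
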